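import Mathlib
import Summits.Ventures.LatticeQCDFlow.Exactness.IMHKernel
import Summits.Ventures.LatticeQCDFlow.TrivializingMaps.DefectLogWeight
import Summits.Ventures.LatticeQCDFlow.TrivializingMaps.LogWeightDensity
import Summits.Ventures.LatticeQCDFlow.TrivializingMaps.TrivializingFlow
import Literature.MathematicalPhysics.QuantumFieldTheory.Luscher2010.FlowExistenceProofs
import Literature.Probability.MarkovChains.DoeblinMinorization
import Summits.Ventures.LatticeQCDFlow.TrivializingMaps.JacobianFormula

/-!
# Approximately trivializing flows give EXACT samplers with a certified Doeblin constant

HONEST FRAMING: exact (Metropolis-corrected) sampling algorithms for lattice gauge theory; figures of merit are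
autocorrelation/cost numbers at stated couplings and volumes; no continuum-physics claim.

Venture `LatticeQCDFlow` (cell pub-lqcd), topic `Exactness`, FANOUT row 30 (lean-1).  NEW WORK of the cell:
the link ("§5" of the typed target `DefectControlsLogWeight`, `TrivializingMaps/Truncation.lean` §3)
between the theory-1 chain on Lüscher's trivializing flows (`TrivializingMaps/*`: a flow-equation DEFECT `δ`
makes the flow's output law `q = (𝓕_1)_* D[V]` equal to the Boltzmann law `π = 𝒵⁻¹e^{-S}D[U]` reweighted by a
density `ρ` with `ρ(U) ≤ e^{M} ρ(U')`, `M = 2δ`) and the general-state-space flow-MCMC kernel of this topic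
(`Exactness/IMHKernel.lean`: the independence Metropolis kernel `indepMH q w` with target weight `w`).

* §1 (any measurable space). `density_bounds_of_ratio_le`: if `q = ρ · π` for PROBABILITY measures and
  `ρ x ≤ e^{M} ρ y` for all `x, y`, then `e^{-M} ≤ ρ ≤ e^{M}` (normalisation); `withDensity_inv_density`:
  the importance weight of the target against the model is `w = 1/ρ`, `π = w · q`;
  `indepMH_exact_doeblin_of_density_ratio`: the flow-MCMC kernel `K = indepMH q (1/ρ)` leaves `π` INVARIANT
  (exactness, whatever `M`), accepts from every state with probability `≥ e^{-M}`, and satisfies DOEBLIN's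
  minorisation `K(x, ·) ≥ e^{-M} π(·)` from every state `x` — the hypothesis under which the chain is
  uniformly ergodic at geometric rate `(1 - e^{-M})^t` in total variation (Meyn–Tweedie Thm 16.2.4; the TV
  contraction step is not formalised here).
* §2 (lattice, `SU(n)^E`). `flowSampler_exact_doeblin_of_osc` / `_of_defect`: for a smooth action `S`, a
  jointly smooth flow action `S̃_t`, `𝓕` integrating `Z_t = -∂S̃_t`, and a pulled-back log-weight
  oscillation `≤ M` — in particular (`_of_defect`) a uniform defect `|𝓛_t S̃_t - S - Ċ_t| ≤ δ` of Lüscher's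
  equation (4.5) on `[0,1] × SU(n)^E`, `M = 2δ` — the sampler "propose `U ∼ (𝓕_1)_* D[V]`, accept with
  `min(1, w(U')/w(U))`" is EXACT for `𝒵⁻¹e^{-S}D[U]`, has acceptance `≥ e^{-M}` from every state and Doeblin
  constant `e^{-M}`.  Modulo the Jacobian formula (3.9) (`JacobianFormula d L n`, hypothesis); §3.1's global
  existence is the tree theorem `Luscher2010.flowGlobalExistence_holds`.

So the sup-norm of the trivializing-flow defect is a PROVABLE surrogate objective for an exact sampler:
`δ` certifies acceptance `≥ e^{-2δ}` and a volume-independent-in-form mixing floor — the quantitative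
content of "approximately trivializing maps + Metropolis correction" (Lüscher 2010 §6; Albergo–Kanwar–
Shanahan 2019 §II.C).  Printed counterparts named only; nothing here is cited as a fact.
-/

namespace Summit.Ventures.LatticeQCDFlow.Exactness

open MeasureTheory ProbabilityTheory
open scoped ENNReal

/-! ## §1. General state space: a density-ratio bound gives an exact sampler with a Doeblin constant -/

section General

variable {Ω : Type*} [MeasurableSpace Ω]

/-- **Two-sided bounds from a ratio bound.**  If `q = ρ · π` for probability measures `π, q` and
`ρ x ≤ e^{M} ρ y` for all `x, y`, then `e^{-M} ≤ ρ x ≤ e^{M}` (integrate the ratio bound against `π`: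
`∫ ρ dπ = q(Ω) = 1`). -/
theorem density_bounds_of_ratio_le {π q : Measure Ω} [IsProbabilityMeasure π] [IsProbabilityMeasure q]
    {ρ : Ω → ℝ} (hq : q = π.withDensity fun x => ENNReal.ofReal (ρ x)) {M : ℝ}
    (hM : ∀ x y, ρ x ≤ Real.exp M * ρ y) (x : Ω) :
    Real.exp (-M) ≤ ρ x ∧ ρ x ≤ Real.exp M := by
  have hone : ∫⁻ y, ENNReal.ofReal (ρ y) ∂π = 1 := by
    have h : q Set.univ = 1 := measure_univ
    rwa [hq, withDensity_apply _ MeasurableSet.univ, Measure.restrict_univ] at h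
  have hMpos : 0 < Real.exp M := Real.exp_pos M
  constructor
  · -- every `ρ y ≤ e^M ρ x`, so `1 = ∫ ρ dπ ≤ e^M ρ x`
    have hle : ∫⁻ y, ENNReal.ofReal (ρ y) ∂π ≤ ENNReal.ofReal (Real.exp M * ρ x) := by
      calc ∫⁻ y, ENNReal.ofReal (ρ y) ∂π ≤ ∫⁻ _, ENNReal.ofReal (Real.exp M * ρ x) ∂π :=
            lintegral_mono fun y => ENNReal.ofReal_le_ofReal (hM y x)
        _ = ENNReal.ofReal (Real.exp M * ρ x) := by rw [lintegral_const, measure_univ, mul_one]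
    rw [hone, ENNReal.one_le_ofReal] at hle
    have h : Real.exp (-M) * 1 ≤ Real.exp (-M) * (Real.exp M * ρ x) :=
      mul_le_mul_of_nonneg_left hle (Real.exp_pos _).le
    rwa [mul_one, ← mul_assoc, ← Real.exp_add, neg_add_cancel, Real.exp_zero, one_mul] at h
  · -- every `ρ y ≥ e^{-M} ρ x`, so `1 = ∫ ρ dπ ≥ e^{-M} ρ x`
    have hge : ENNReal.ofReal (Real.exp (-M) * ρ x) ≤ ∫⁻ y, ENNReal.ofReal (ρ y) ∂π := by
      calc ENNReal.ofReal (Real.exp (-M) * ρ x) = ∫⁻ _, ENNReal.ofReal (Real.exp (-M) * ρ x) ∂π := by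
            rw [lintegral_const, measure_univ, mul_one]
        _ ≤ ∫⁻ y, ENNReal.ofReal (ρ y) ∂π := lintegral_mono fun y => ENNReal.ofReal_le_ofReal (by
            have h := hM x y
            have h' : Real.exp (-M) * ρ x ≤ Real.exp (-M) * (Real.exp M * ρ y) :=
              mul_le_mul_of_nonneg_left h (Real.exp_pos _).le
            rwa [← mul_assoc, ← Real.exp_add, neg_add_cancel, Real.exp_zero, one_mul] at h')
    rw [hone, ENNReal.ofReal_le_one] at hge
    have h : Real.exp M * (Real.exp (-M) * ρ x) ≤ Real.exp M * 1 :=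
      mul_le_mul_of_nonneg_left hge hMpos.le
    rwa [mul_one, ← mul_assoc, ← Real.exp_add, add_neg_cancel, Real.exp_zero, one_mul] at h

/-- **The importance weight of the target against the model is `1/ρ`**: if `q = ρ · π` with `ρ > 0`
measurable then `π = (1/ρ) · q`. -/
theorem withDensity_inv_density {π q : Measure Ω} {ρ : Ω → ℝ} (hρm : Measurable ρ) (hρ0 : ∀ x, 0 < ρ x)
    (hq : q = π.withDensity fun x => ENNReal.ofReal (ρ x)) :
    (q.withDensity fun x => ENNReal.ofReal (ρ x)⁻¹) = π := by
  have hg : Measurable fun x => ENNReal.ofReal (ρ x)⁻¹ :=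
    ENNReal.measurable_ofReal.comp (measurable_inv.comp hρm)
  rw [hq, ← withDensity_mul _ hρm.ennreal_ofReal hg]
  have h1 : ((fun x => ENNReal.ofReal (ρ x)) * fun x => ENNReal.ofReal (ρ x)⁻¹) = 1 := by
    funext x
    rw [Pi.mul_apply, Pi.one_apply, ← ENNReal.ofReal_mul (hρ0 x).le, mul_inv_cancel₀ (hρ0 x).ne',
      ENNReal.ofReal_one]
  rw [h1, withDensity_one]

omit [MeasurableSpace Ω] in
/-- The acceptance probability of the flow-MCMC kernel with weight `w = 1/ρ` is at least `e^{-M}` for EVERY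
proposed move, when `ρ x ≤ e^{M} ρ y` for all `x, y`. -/
theorem imhAcceptE_inv_ge {ρ : Ω → ℝ} (hρ0 : ∀ x, 0 < ρ x) {M : ℝ} (hM : ∀ x y, ρ x ≤ Real.exp M * ρ y)
    (x y : Ω) : ENNReal.ofReal (Real.exp (-M)) ≤ imhAcceptE (fun z => (ρ z)⁻¹) x y := by
  unfold imhAcceptE imhAccept
  refine ENNReal.ofReal_le_ofReal (le_min ?_ ?_)
  · -- `1 ≤ e^{M}`: take `x = y` in the ratio bound
    have h := hM x x
    have h1 : 1 ≤ Real.exp M :=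
      le_of_mul_le_mul_right (by linarith : 1 * ρ x ≤ Real.exp M * ρ x) (hρ0 x)
    rw [Real.exp_neg]
    exact inv_le_one_of_one_le₀ h1
  · -- `(ρ y)⁻¹ / (ρ x)⁻¹ = ρ x / ρ y ≥ e^{-M}`
    rw [inv_div_inv, le_div_iff₀ (hρ0 y), Real.exp_neg]
    have h := hM y x
    have h' : (Real.exp M)⁻¹ * ρ y ≤ (Real.exp M)⁻¹ * (Real.exp M * ρ x) :=
      mul_le_mul_of_nonneg_left h (inv_nonneg.2 (Real.exp_pos _).le)
    rwa [← mul_assoc, inv_mul_cancel₀ (Real.exp_pos M).ne', one_mul] at h'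

/-- **Exact sampler with a certified Doeblin constant from a density-ratio bound** (general state space).
Let `π, q` be probability measures with `q = ρ · π`, `ρ > 0` measurable, `ρ x ≤ e^{M} ρ y` for all `x, y`
(log-density oscillation `≤ M`).  Then the independence Metropolis kernel `K = indepMH q (1/ρ)` (propose from
the model `q`, accept with `min(1, ρ(x)/ρ(y))`):
(i) leaves the target `π` INVARIANT (exactness); (ii) accepts from every state with probability `≥ e^{-M}`;
(iii) satisfies Doeblin's minorisation `e^{-M} · π(B) ≤ K(x, B)` for every state `x` and measurable `B`. -/
theorem indepMH_exact_doeblin_of_density_ratio {π q : Measure Ω} [IsProbabilityMeasure π]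
    [IsProbabilityMeasure q] {ρ : Ω → ℝ} (hρm : Measurable ρ) (hρ0 : ∀ x, 0 < ρ x)
    (hq : q = π.withDensity fun x => ENNReal.ofReal (ρ x)) {M : ℝ}
    (hM : ∀ x y, ρ x ≤ Real.exp M * ρ y) :
    Kernel.Invariant (indepMH q fun x => (ρ x)⁻¹) π ∧
      (∀ x, ENNReal.ofReal (Real.exp (-M)) ≤ imhAcceptMass q (fun x => (ρ x)⁻¹) x) ∧
      ∀ (x : Ω) {B : Set Ω}, MeasurableSet B →
        ENNReal.ofReal (Real.exp (-M)) * π B ≤ indepMH q (fun x => (ρ x)⁻¹) x B := by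
  have hw : Measurable fun x => (ρ x)⁻¹ := hρm.inv
  have hw0 : ∀ x, 0 < (ρ x)⁻¹ := fun x => inv_pos.2 (hρ0 x)
  have hwM : ∀ x, (ρ x)⁻¹ ≤ Real.exp M := fun x => by
    have h := (density_bounds_of_ratio_le hq hM x).1
    calc (ρ x)⁻¹ ≤ (Real.exp (-M))⁻¹ := inv_anti₀ (Real.exp_pos _) h
      _ = Real.exp M := by rw [Real.exp_neg, inv_inv]
  have hπ := withDensity_inv_density hρm hρ0 hq
  refine ⟨?_, fun x => ?_, fun x B hB => ?_⟩
  · have h := indepMH_invariant (q := q) hw hw0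
    rwa [hπ] at h
  · unfold imhAcceptMass
    calc ENNReal.ofReal (Real.exp (-M)) = ∫⁻ _, ENNReal.ofReal (Real.exp (-M)) ∂q := by
          rw [lintegral_const, measure_univ, mul_one]
      _ ≤ ∫⁻ y, imhAcceptE (fun z => (ρ z)⁻¹) x y ∂q := lintegral_mono fun y => imhAcceptE_inv_ge hρ0 hM x y
  · have h := indepMH_apply_ge (q := q) hw hw0 hwM x hB
    rwa [hπ, ← ENNReal.ofReal_inv_of_pos (Real.exp_pos M), ← Real.exp_neg] at h

end General

/-! ## §2. The lattice: flow-equation defect ⇒ exact flow sampler with Doeblin constant `e^{-2δ}` -/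

section Lattice

open Literature.MathematicalPhysics.QuantumFieldTheory
open Literature.MathematicalPhysics.QuantumFieldTheory.Luscher2010
open Summit.Ventures.LatticeQCDFlow.TrivializingMaps
open scoped Matrix Matrix.Norms.Frobenius ContDiff

variable {d L n : ℕ} [NeZero L]

/-- **Exact flow sampler with certified efficiency from a log-weight oscillation bound** (modulo (3.9)).
Smooth action `S`, jointly smooth flow action `S̃_t`, `𝓕` integrating `Z_t = -∂S̃_t`; `q` = the flow's output
law `(𝓕_1)_* D[V]`; if the pulled-back log-weight `R(V) = ∫₀¹ div Z_s(𝓕_s V) ds - S(𝓕_1 V)` oscillates by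
at most `M`, then with the target `π = 𝒵⁻¹ e^{-S} D[U]` there is a measurable weight `w` (`= dπ/dq`),
`e^{-M} ≤ w ≤ e^{M}`, `π = w · q`, such that the flow-MCMC kernel `indepMH q w` is EXACT for `π`, accepts
from every configuration with probability `≥ e^{-M}`, and obeys Doeblin `K(U, ·) ≥ e^{-M} π(·)`. -/
theorem flowSampler_exact_doeblin_of_osc (hJ : JacobianFormula d L n) (B : SuBasis n)
    {S : AmbConfig d L n → ℝ} (hS : ContDiff ℝ ∞ S) {F : ℝ → AmbConfig d L n → ℝ}
    (hF : ContDiff ℝ ∞ fun p : ℝ × AmbConfig d L n => F p.1 p.2)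
    {Φ : ℝ → GaugeConfig d L (Matrix.specialUnitaryGroup (Fin n) ℂ) →
      GaugeConfig d L (Matrix.specialUnitaryGroup (Fin n) ℂ)}
    (hΦ : IsFlowMap (fun t W => -linkGrad B (F t) W) Φ) {M : ℝ}
    (hosc : ∀ V V' : GaugeConfig d L (Matrix.specialUnitaryGroup (Fin n) ℂ),
      |((∫ s in (0 : ℝ)..1, linkDiv B (fun W => -linkGrad B (F s) W) (WilsonFlow.coeConfig (Φ s V))) -
          S (WilsonFlow.coeConfig (Φ 1 V))) -
        ((∫ s in (0 : ℝ)..1, linkDiv B (fun W => -linkGrad B (F s) W) (WilsonFlow.coeConfig (Φ s V'))) -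
          S (WilsonFlow.coeConfig (Φ 1 V')))| ≤ M)
    (q : Measure (GaugeConfig d L (Matrix.specialUnitaryGroup (Fin n) ℂ))) [IsProbabilityMeasure q]
    (hq : q = Measure.map (Φ 1) (trivialMeasure (Matrix.specialUnitaryGroup (Fin n) ℂ) d L)) :
    ∃ w : GaugeConfig d L (Matrix.specialUnitaryGroup (Fin n) ℂ) → ℝ, Measurable w ∧
      (∀ U, Real.exp (-M) ≤ w U) ∧ (∀ U, w U ≤ Real.exp M) ∧
      (q.withDensity fun U => ENNReal.ofReal (w U)) =
        boltzmannMeasure (fun U : GaugeConfig d L (Matrix.specialUnitaryGroup (Fin n) ℂ) =>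
          S (WilsonFlow.coeConfig U)) ∧
      Kernel.Invariant (indepMH q w)
        (boltzmannMeasure fun U : GaugeConfig d L (Matrix.specialUnitaryGroup (Fin n) ℂ) =>
          S (WilsonFlow.coeConfig U)) ∧
      (∀ U, ENNReal.ofReal (Real.exp (-M)) ≤ imhAcceptMass q w U) ∧
      ∀ (U : GaugeConfig d L (Matrix.specialUnitaryGroup (Fin n) ℂ))
        {A : Set (GaugeConfig d L (Matrix.specialUnitaryGroup (Fin n) ℂ))}, MeasurableSet A →
        ENNReal.ofReal (Real.exp (-M)) *
            boltzmannMeasure (fun U : GaugeConfig d L (Matrix.specialUnitaryGroup (Fin n) ℂ) =>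
              S (WilsonFlow.coeConfig U)) A ≤ indepMH q w U A := by
  haveI : SecondCountableTopology (Matrix (Fin n) (Fin n) ℂ) :=
    inferInstanceAs (SecondCountableTopology (Fin n → Fin n → ℂ))
  haveI : SecondCountableTopology (Matrix.specialUnitaryGroup (Fin n) ℂ) :=
    Topology.IsEmbedding.subtypeVal.secondCountableTopology
  -- measurability of `Φ 1` from the joint continuity of THE global flow (§3.1, tree theorem)
  obtain ⟨hΦc, -⟩ := isFlowMap_continuous_unique flowGlobalExistence_holds
    (contDiff_one_neg_linkGrad_param B hF) (isTangent_neg_linkGrad B F) hΦ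
  have hmeas : Measurable (Φ 1) := (hΦc.comp (continuous_const.prodMk continuous_id)).measurable
  obtain ⟨ρ, hρm, hρ0, hmap, hratio⟩ :=
    exists_density_of_logWeight_osc flowGlobalExistence_holds hJ B hS hF hΦ hmeas hosc
  have hS'c : Continuous fun U : GaugeConfig d L (Matrix.specialUnitaryGroup (Fin n) ℂ) =>
      S (WilsonFlow.coeConfig U) := hS.continuous.comp WilsonFlow.continuous_coeConfig
  haveI := isProbabilityMeasure_boltzmannMeasure (d := d) (L := L) hS'c
  rw [← hq] at hmap
  obtain ⟨hinv, hacc, hdoeb⟩ := indepMH_exact_doeblin_of_density_ratio hρm hρ0 hmap hratio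
  refine ⟨fun U => (ρ U)⁻¹, hρm.inv, fun U => ?_, fun U => ?_, withDensity_inv_density hρm hρ0 hmap,
    hinv, hacc, fun U A hA => hdoeb U hA⟩
  · have h := (density_bounds_of_ratio_le hmap hratio U).2
    rw [Real.exp_neg]
    exact inv_anti₀ (hρ0 U) h
  · have h := (density_bounds_of_ratio_le hmap hratio U).1
    calc (ρ U)⁻¹ ≤ (Real.exp (-M))⁻¹ := inv_anti₀ (Real.exp_pos _) h
      _ = Real.exp M := by rw [Real.exp_neg, inv_inv]

/-- **Approximately trivializing flows give exact samplers with Doeblin constant `e^{-2δ}`** (modulo (3.9)):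
if the flow action `S̃_t` solves Lüscher's trivializing-flow equation (4.5) up to a uniform defect,
`|(𝓛_t S̃_t)(U) - S(U) - Ċ_t| ≤ δ` on `[0,1] × SU(n)^E` for some field-independent `Ċ`, then the exact sampler
"propose from the flow `𝓕_1` of `Z_t = -∂S̃_t`, Metropolis-correct" has acceptance `≥ e^{-2δ}` from every
state and Doeblin constant `e^{-2δ}` — the sup-norm of the defect is a provable surrogate objective. -/
theorem flowSampler_exact_doeblin_of_defect (hJ : JacobianFormula d L n) (B : SuBasis n)
    {S : AmbConfig d L n → ℝ} (hS : ContDiff ℝ ∞ S) {F : ℝ → AmbConfig d L n → ℝ}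
    (hF : ContDiff ℝ ∞ fun p : ℝ × AmbConfig d L n => F p.1 p.2)
    {Φ : ℝ → GaugeConfig d L (Matrix.specialUnitaryGroup (Fin n) ℂ) →
      GaugeConfig d L (Matrix.specialUnitaryGroup (Fin n) ℂ)}
    (hΦ : IsFlowMap (fun t W => -linkGrad B (F t) W) Φ) {c : ℝ → ℝ} {δ : ℝ}
    (hδ : ∀ t ∈ Set.Icc (0 : ℝ) 1, ∀ U : GaugeConfig d L (Matrix.specialUnitaryGroup (Fin n) ℂ),
      |luscherL B S t (F t) (WilsonFlow.coeConfig U) - S (WilsonFlow.coeConfig U) - c t| ≤ δ)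
    (q : Measure (GaugeConfig d L (Matrix.specialUnitaryGroup (Fin n) ℂ))) [IsProbabilityMeasure q]
    (hq : q = Measure.map (Φ 1) (trivialMeasure (Matrix.specialUnitaryGroup (Fin n) ℂ) d L)) :
    ∃ w : GaugeConfig d L (Matrix.specialUnitaryGroup (Fin n) ℂ) → ℝ, Measurable w ∧
      (∀ U, Real.exp (-(2 * δ)) ≤ w U) ∧ (∀ U, w U ≤ Real.exp (2 * δ)) ∧
      (q.withDensity fun U => ENNReal.ofReal (w U)) =
        boltzmannMeasure (fun U : GaugeConfig d L (Matrix.specialUnitaryGroup (Fin n) ℂ) =>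
          S (WilsonFlow.coeConfig U)) ∧
      Kernel.Invariant (indepMH q w)
        (boltzmannMeasure fun U : GaugeConfig d L (Matrix.specialUnitaryGroup (Fin n) ℂ) =>
          S (WilsonFlow.coeConfig U)) ∧
      (∀ U, ENNReal.ofReal (Real.exp (-(2 * δ))) ≤ imhAcceptMass q w U) ∧
      ∀ (U : GaugeConfig d L (Matrix.specialUnitaryGroup (Fin n) ℂ))
        {A : Set (GaugeConfig d L (Matrix.specialUnitaryGroup (Fin n) ℂ))}, MeasurableSet A →
        ENNReal.ofReal (Real.exp (-(2 * δ))) *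
            boltzmannMeasure (fun U : GaugeConfig d L (Matrix.specialUnitaryGroup (Fin n) ℂ) =>
              S (WilsonFlow.coeConfig U)) A ≤ indepMH q w U A :=
  flowSampler_exact_doeblin_of_osc hJ B hS hF hΦ
    (fun V V' => logWeight_osc_le_of_defect B hS hF hΦ hδ V V') q hq


/-! ## §3. Certified geometric mixing (appended): Doeblin ⇒ uniform ergodicity, setwise

With the tree's general-space Doeblin theorem (`Literature.Probability.MarkovChains.Doeblin`, Meyn–Tweedie
Thm 16.2.4, formalised): the flow sampler of an approximately trivializing flow converges to the Boltzmann
law geometrically from EVERY start, `|μKᵗ(A) - π(A)| ≤ (1 - e^{-2δ})ᵗ` for every set `A`. -/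

/-- **Certified geometric mixing from the flow-equation defect** (modulo (3.9)): under the hypotheses of
`flowSampler_exact_doeblin_of_defect` — smooth action, jointly smooth flow action with uniform defect `δ` of
Lüscher's equation (4.5), `𝓕` integrating `-∂S̃_t`, `q = (𝓕_1)_* D[V]` — the flow-MCMC kernel `K = indepMH q w`
(with the weight `w = dπ/dq` of that theorem) satisfies, for EVERY initial probability law `μ`, every `t` and
every set `A`: `|(μKᵗ)(A) - π(A)| ≤ (1 - e^{-2δ})ᵗ`, `π = 𝒵⁻¹e^{-S}D[U]`.  The autocorrelation / mixing cost
of the exact sampler is thus bounded by a function of the defect alone. -/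
theorem flowSampler_mixing_of_defect (hJ : JacobianFormula d L n) (B : SuBasis n)
    {S : AmbConfig d L n → ℝ} (hS : ContDiff ℝ ∞ S) {F : ℝ → AmbConfig d L n → ℝ}
    (hF : ContDiff ℝ ∞ fun p : ℝ × AmbConfig d L n => F p.1 p.2)
    {Φ : ℝ → GaugeConfig d L (Matrix.specialUnitaryGroup (Fin n) ℂ) →
      GaugeConfig d L (Matrix.specialUnitaryGroup (Fin n) ℂ)}
    (hΦ : IsFlowMap (fun t W => -linkGrad B (F t) W) Φ) {c : ℝ → ℝ} {δ : ℝ}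
    (hδ : ∀ t ∈ Set.Icc (0 : ℝ) 1, ∀ U : GaugeConfig d L (Matrix.specialUnitaryGroup (Fin n) ℂ),
      |luscherL B S t (F t) (WilsonFlow.coeConfig U) - S (WilsonFlow.coeConfig U) - c t| ≤ δ)
    (q : Measure (GaugeConfig d L (Matrix.specialUnitaryGroup (Fin n) ℂ))) [IsProbabilityMeasure q]
    (hq : q = Measure.map (Φ 1) (trivialMeasure (Matrix.specialUnitaryGroup (Fin n) ℂ) d L)) :
    ∃ w : GaugeConfig d L (Matrix.specialUnitaryGroup (Fin n) ℂ) → ℝ, Measurable w ∧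
      (q.withDensity fun U => ENNReal.ofReal (w U)) =
        boltzmannMeasure (fun U : GaugeConfig d L (Matrix.specialUnitaryGroup (Fin n) ℂ) =>
          S (WilsonFlow.coeConfig U)) ∧
      ∀ (μ : Measure (GaugeConfig d L (Matrix.specialUnitaryGroup (Fin n) ℂ))) [IsProbabilityMeasure μ]
        (t : ℕ) (A : Set (GaugeConfig d L (Matrix.specialUnitaryGroup (Fin n) ℂ))),
        |((fun m : Measure (GaugeConfig d L (Matrix.specialUnitaryGroup (Fin n) ℂ)) =>
              m.bind (indepMH q w))^[t] μ).real A -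
            (boltzmannMeasure fun U : GaugeConfig d L (Matrix.specialUnitaryGroup (Fin n) ℂ) =>
              S (WilsonFlow.coeConfig U)).real A| ≤ (1 - Real.exp (-(2 * δ))) ^ t := by
  obtain ⟨w, hw, -, -, hπ, hinv, -, hdoeb⟩ := flowSampler_exact_doeblin_of_defect hJ B hS hF hΦ hδ q hq
  haveI : Fact (Measurable w) := ⟨hw⟩
  have hS'c : Continuous fun U : GaugeConfig d L (Matrix.specialUnitaryGroup (Fin n) ℂ) =>
      S (WilsonFlow.coeConfig U) := hS.continuous.comp WilsonFlow.continuous_coeConfig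
  haveI := isProbabilityMeasure_boltzmannMeasure (d := d) (L := L) hS'c
  obtain ⟨U₀⟩ : Nonempty (GaugeConfig d L (Matrix.specialUnitaryGroup (Fin n) ℂ)) := inferInstance
  have hδ0 : 0 ≤ δ := (abs_nonneg _).trans (hδ 0 ⟨le_rfl, zero_le_one⟩ U₀)
  have hε1 : ENNReal.ofReal (Real.exp (-(2 * δ))) ≤ 1 :=
    ENNReal.ofReal_le_one.2 (Real.exp_le_one_iff.2 (by linarith))
  refine ⟨w, hw, hπ, fun μ _ t A => ?_⟩
  have h := Literature.Probability.MarkovChains.Doeblin.doeblin_iterate_sub_invariant_le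
    (κ := indepMH q w) (ε := ENNReal.ofReal (Real.exp (-(2 * δ))))
    (fun x B hB => hdoeb x hB) hε1 hinv μ t A
  rwa [ENNReal.toReal_ofReal (Real.exp_pos _).le] at h


/-! ## §4. Unconditional forms (appended): the Jacobian formula (3.9) is the tree theorem
`TrivializingMaps.jacobianFormula_holds` (lean-2, `TrivializingMaps/JacobianFormula.lean`), so the hypothesis
`JacobianFormula d L n` of §2–§3 is discharged. -/

/-- **Approximately trivializing flows give exact samplers with Doeblin constant `e^{-2δ}` — UNCONDITIONAL.**
Smooth action `S`, jointly smooth flow action `S̃_t` with uniform defect `|𝓛_t S̃_t - S - Ċ_t| ≤ δ` of Lüscher's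
equation (4.5) on `[0,1] × SU(n)^E`, `𝓕` integrating `-∂S̃_t`, `q = (𝓕_1)_* D[V]`: there is a measurable weight
`w`, `e^{-2δ} ≤ w ≤ e^{2δ}`, `w · q = 𝒵⁻¹e^{-S}D[U]`, such that the flow-MCMC kernel `indepMH q w` is EXACT,
accepts from every configuration with probability `≥ e^{-2δ}` and has Doeblin constant `e^{-2δ}`. -/
theorem flowSampler_exact_doeblin (B : SuBasis n)
    {S : AmbConfig d L n → ℝ} (hS : ContDiff ℝ ∞ S) {F : ℝ → AmbConfig d L n → ℝ}
    (hF : ContDiff ℝ ∞ fun p : ℝ × AmbConfig d L n => F p.1 p.2)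
    {Φ : ℝ → GaugeConfig d L (Matrix.specialUnitaryGroup (Fin n) ℂ) →
      GaugeConfig d L (Matrix.specialUnitaryGroup (Fin n) ℂ)}
    (hΦ : IsFlowMap (fun t W => -linkGrad B (F t) W) Φ) {c : ℝ → ℝ} {δ : ℝ}
    (hδ : ∀ t ∈ Set.Icc (0 : ℝ) 1, ∀ U : GaugeConfig d L (Matrix.specialUnitaryGroup (Fin n) ℂ),
      |luscherL B S t (F t) (WilsonFlow.coeConfig U) - S (WilsonFlow.coeConfig U) - c t| ≤ δ)
    (q : Measure (GaugeConfig d L (Matrix.specialUnitaryGroup (Fin n) ℂ))) [IsProbabilityMeasure q]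
    (hq : q = Measure.map (Φ 1) (trivialMeasure (Matrix.specialUnitaryGroup (Fin n) ℂ) d L)) :
    ∃ w : GaugeConfig d L (Matrix.specialUnitaryGroup (Fin n) ℂ) → ℝ, Measurable w ∧
      (∀ U, Real.exp (-(2 * δ)) ≤ w U) ∧ (∀ U, w U ≤ Real.exp (2 * δ)) ∧
      (q.withDensity fun U => ENNReal.ofReal (w U)) =
        boltzmannMeasure (fun U : GaugeConfig d L (Matrix.specialUnitaryGroup (Fin n) ℂ) =>
          S (WilsonFlow.coeConfig U)) ∧
      Kernel.Invariant (indepMH q w)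
        (boltzmannMeasure fun U : GaugeConfig d L (Matrix.specialUnitaryGroup (Fin n) ℂ) =>
          S (WilsonFlow.coeConfig U)) ∧
      (∀ U, ENNReal.ofReal (Real.exp (-(2 * δ))) ≤ imhAcceptMass q w U) ∧
      ∀ (U : GaugeConfig d L (Matrix.specialUnitaryGroup (Fin n) ℂ))
        {A : Set (GaugeConfig d L (Matrix.specialUnitaryGroup (Fin n) ℂ))}, MeasurableSet A →
        ENNReal.ofReal (Real.exp (-(2 * δ))) *
            boltzmannMeasure (fun U : GaugeConfig d L (Matrix.specialUnitaryGroup (Fin n) ℂ) =>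
              S (WilsonFlow.coeConfig U)) A ≤ indepMH q w U A :=
  flowSampler_exact_doeblin_of_defect jacobianFormula_holds B hS hF hΦ hδ q hq

/-- **Certified geometric mixing from the flow-equation defect — UNCONDITIONAL**: for every initial probability
law `μ`, every `t` and every set `A`, `|(μKᵗ)(A) - π(A)| ≤ (1 - e^{-2δ})ᵗ` for the flow-MCMC kernel
`K = indepMH q w` of `flowSampler_exact_doeblin`, `π = 𝒵⁻¹e^{-S}D[U]`. -/
theorem flowSampler_mixing (B : SuBasis n)
    {S : AmbConfig d L n → ℝ} (hS : ContDiff ℝ ∞ S) {F : ℝ → AmbConfig d L n → ℝ}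
    (hF : ContDiff ℝ ∞ fun p : ℝ × AmbConfig d L n => F p.1 p.2)
    {Φ : ℝ → GaugeConfig d L (Matrix.specialUnitaryGroup (Fin n) ℂ) →
      GaugeConfig d L (Matrix.specialUnitaryGroup (Fin n) ℂ)}
    (hΦ : IsFlowMap (fun t W => -linkGrad B (F t) W) Φ) {c : ℝ → ℝ} {δ : ℝ}
    (hδ : ∀ t ∈ Set.Icc (0 : ℝ) 1, ∀ U : GaugeConfig d L (Matrix.specialUnitaryGroup (Fin n) ℂ),
      |luscherL B S t (F t) (WilsonFlow.coeConfig U) - S (WilsonFlow.coeConfig U) - c t| ≤ δ)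
    (q : Measure (GaugeConfig d L (Matrix.specialUnitaryGroup (Fin n) ℂ))) [IsProbabilityMeasure q]
    (hq : q = Measure.map (Φ 1) (trivialMeasure (Matrix.specialUnitaryGroup (Fin n) ℂ) d L)) :
    ∃ w : GaugeConfig d L (Matrix.specialUnitaryGroup (Fin n) ℂ) → ℝ, Measurable w ∧
      (q.withDensity fun U => ENNReal.ofReal (w U)) =
        boltzmannMeasure (fun U : GaugeConfig d L (Matrix.specialUnitaryGroup (Fin n) ℂ) =>
          S (WilsonFlow.coeConfig U)) ∧
      ∀ (μ : Measure (GaugeConfig d L (Matrix.specialUnitaryGroup (Fin n) ℂ))) [IsProbabilityMeasure μ]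
        (t : ℕ) (A : Set (GaugeConfig d L (Matrix.specialUnitaryGroup (Fin n) ℂ))),
        |((fun m : Measure (GaugeConfig d L (Matrix.specialUnitaryGroup (Fin n) ℂ)) =>
              m.bind (indepMH q w))^[t] μ).real A -
            (boltzmannMeasure fun U : GaugeConfig d L (Matrix.specialUnitaryGroup (Fin n) ℂ) =>
              S (WilsonFlow.coeConfig U)).real A| ≤ (1 - Real.exp (-(2 * δ))) ^ t :=
  flowSampler_mixing_of_defect jacobianFormula_holds B hS hF hΦ hδ q hq

end Lattice

end Summit.Ventures.LatticeQCDFlow.Exactness
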